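import Mathlib.MeasureTheory.Measure.Haar.Basic
import Mathlib.MeasureTheory.Measure.Prod
import Mathlib.MeasureTheory.Constructions.BorelSpace.Basic
import Mathlib.Topology.Algebra.ContinuousMonoidHom
import HarnessLib

/-!
# The right factor of a product decomposition of a Haar measure is a Haar measure
# (Gelbart, *Automorphic forms on adele groups* (1975), Remark 9.23: `dg = dg_∞ · dg_f` on `G(𝔸) = G_∞ × G(𝔸_f)`)

Topic `MeasureTheory/Measure`; namespace `Literature.MeasureTheory.Measure` (companion of ★ `ProdLeftCancel`).  THEOREMS ONLY (no definition, no instance,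
no notation, no named fact, no `sorry`).  Cell `hodgecm-mathlib`, programme P3 «U3-mult», ROAD «TF» (assembler J2 of the letter `ArchFinTraceSplit`, which
quantifies over EVERY finite-adelic factor measure `νf` with `ν = e⁻¹_*(νinf ⊗ νf)`; this file makes that quantifier harmless).

THE STATEMENT (`isHaarMeasure_of_map_prod_eq`).  Let `e : A × B ≃* G` be a group isomorphism of topological groups which is a homeomorphism
(`he : Continuous e`, `hes : Continuous e.symm`), `μ` a (left) Haar measure on the locally compact group `A`, `ν` a Haar measure on `G`, and `ρ` ANY
measure on `B` with `ν = e_* (μ ⊗ ρ)`.  Then `ρ` is a Haar measure on `B`.  No s-finiteness of `ρ` is assumed: the rectangle formula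
`(μ ⊗ ρ)(S × T) = μ(S) ρ(T)` (`prod_prod_of_ne_zero`, §1) holds for an ARBITRARY second factor as soon as `μ ⊗ ρ ≠ 0` (Mathlib's `Measure.prod` is the
monadic bind, which is either the genuine iterated integral or `0`), and `μ ⊗ ρ ≠ 0` because `ν ≠ 0`.  Then (§2): `ρ` is finite on compacta (evaluate on
`S₀ × T`, `S₀` a compact neighbourhood of `1`, `0 < μ(S₀) < ∞`, `e(S₀ × T)` compact); `ρ` is left invariant (`ν` is invariant under `e(1, b)`, whose action
on `e_*(μ ⊗ ρ)` is `(a, y) ↦ (a, b y)`; cancel `μ(S₀)`); `ρ` is positive on non-empty open sets (`e(A × U)` is open and non-empty).  This is the «`dg_f` is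
determined by `dg` and `dg_∞`» half of [Gelbart1975, Remark 9.23] in the form the adelic consumers need (★ `UnitaryGroup.exists_isHaarMeasure_arch_eq_map_prod_rpMeasure`,
PH `IsProductHaar` of the TF line).  HONEST LABEL: generic measure theory; HC_CM is proved only modulo the printed citations until rung 0 closes, and this file
moves no count.

## References
* S. Gelbart, *Automorphic forms on adele groups*, Ann. of Math. Stud. 83 (1975), Remark 9.23 [Gelbart1975].
* A. Deitmar, S. Echterhoff, *Principles of Harmonic Analysis*, 2nd ed. (2014), §1.5 (product Haar measures) [DeitmarEchterhoff2014].
-/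

set_option autoImplicit false

noncomputable section

open _root_.MeasureTheory _root_.MeasureTheory.Measure Set Filter
open scoped ENNReal Topology

namespace Literature.MeasureTheory.Measure

/-! ## §1 The rectangle formula for an arbitrary second factor -/

/-- **`(μ ⊗ ρ)(S × T) = μ(S) · ρ(T)` WITHOUT s-finiteness of `ρ`, as soon as `μ ⊗ ρ ≠ 0`.**  Mathlib's `Measure.prod μ ρ` is the bind
`μ >>= (x ↦ (Prod.mk x)_* ρ)`; it is non-zero only if the kernel `x ↦ (Prod.mk x)_* ρ` is a.e.-measurable, and then `bind_apply` evaluates it as the iterated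
integral `∫⁻ x, ρ(Prod.mk x ⁻¹' (S × T)) dμ = ρ(T) μ(S)`. [cite: Gelbart1975, Remark 9.23] -/
theorem prod_prod_of_ne_zero {α β : Type*} [MeasurableSpace α] [MeasurableSpace β] {μ : Measure α} {ρ : Measure β}
    (h : μ.prod ρ ≠ 0) {S : Set α} {T : Set β} (hS : MeasurableSet S) (hT : MeasurableSet T) :
    μ.prod ρ (S ×ˢ T) = μ S * ρ T := by
  classical
  have hf : AEMeasurable (fun x : α => Measure.map (Prod.mk x) ρ) μ := by
    by_contra hf
    apply h
    rw [Measure.prod_def, Measure.bind, Measure.map_of_not_aemeasurable hf, Measure.join_zero]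
  rw [Measure.prod_def, Measure.bind_apply (hS.prod hT) hf]
  have hx : ∀ x, Measure.map (Prod.mk x) ρ (S ×ˢ T) = S.indicator (fun _ => ρ T) x := fun x => by
    rw [Measure.map_apply measurable_prodMk_left (hS.prod hT), Set.mk_preimage_prod_right_eq_if]
    by_cases hxS : x ∈ S
    · rw [if_pos hxS, Set.indicator_of_mem hxS]
    · rw [if_neg hxS, Set.indicator_of_notMem hxS, measure_empty]
  simp_rw [hx]
  rw [lintegral_indicator_const hS, mul_comm]

/-- A pushforward of `μ ⊗ ρ` which is non-zero forces `μ ⊗ ρ ≠ 0`. [cite: Gelbart1975, Remark 9.23] -/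
theorem prod_ne_zero_of_map_ne_zero {α β γ : Type*} [MeasurableSpace α] [MeasurableSpace β] [MeasurableSpace γ] {μ : Measure α} {ρ : Measure β}
    (f : α × β → γ) (h : Measure.map f (μ.prod ρ) ≠ 0) : μ.prod ρ ≠ 0 := by
  intro h0
  apply h
  rw [h0, Measure.map_zero]

/-! ## §2 The right factor of a product decomposition of a Haar measure is Haar -/

variable {A B G : Type*}
  [TopologicalSpace A] [MeasurableSpace A] [BorelSpace A] [Group A] [IsTopologicalGroup A] [LocallyCompactSpace A]
  [TopologicalSpace B] [MeasurableSpace B] [BorelSpace B] [Group B] [IsTopologicalGroup B]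
  [TopologicalSpace G] [MeasurableSpace G] [BorelSpace G] [Group G] [IsTopologicalGroup G]
  [SecondCountableTopologyEither A B]

omit [IsTopologicalGroup A] [LocallyCompactSpace A] [IsTopologicalGroup B] [IsTopologicalGroup G] in
/-- **Transport**: along the measurable equivalence underlying `e`, `ν = e_*(μ ⊗ ρ)` reads `(μ ⊗ ρ)(M) = ν(e '' M)` for EVERY set `M`.
[cite: Gelbart1975, Remark 9.23] -/
theorem prod_apply_eq_measure_image (e : A × B ≃* G) (he : Continuous e) (hes : Continuous e.symm)
    {μ : Measure A} {ρ : Measure B} {ν : Measure G} (h : ν = Measure.map e (μ.prod ρ)) (M : Set (A × B)) :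
    μ.prod ρ M = ν (e '' M) := by
  let E : A × B ≃ₜ G := { e.toEquiv with continuous_toFun := he, continuous_invFun := hes }
  have hE : (E.toMeasurableEquiv : A × B → G) = e := rfl
  have hP : μ.prod ρ = Measure.map E.toMeasurableEquiv.symm ν := by
    rw [h, ← hE, MeasurableEquiv.map_symm_map]
  rw [hP, MeasurableEquiv.map_apply, ← MeasurableEquiv.image_eq_preimage_symm, hE]

omit [IsTopologicalGroup A] [LocallyCompactSpace A] [IsTopologicalGroup B] [IsTopologicalGroup G] in
/-- **The rectangle identity in `G`**: `ν(e(S × T)) = μ(S) ρ(T)` for measurable `S, T` (`ν` Haar, hence `≠ 0`, hence `μ ⊗ ρ ≠ 0`).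
[cite: Gelbart1975, Remark 9.23] -/
theorem measure_image_prod_eq (e : A × B ≃* G) (he : Continuous e) (hes : Continuous e.symm)
    {μ : Measure A} {ρ : Measure B} {ν : Measure G} [ν.IsOpenPosMeasure] (h : ν = Measure.map e (μ.prod ρ))
    {S : Set A} {T : Set B} (hS : MeasurableSet S) (hT : MeasurableSet T) :
    ν (e '' (S ×ˢ T)) = μ S * ρ T := by
  have hν0 : ν ≠ 0 := by
    intro h0
    have h1 : ν Set.univ ≠ 0 := IsOpen.measure_ne_zero ν isOpen_univ Set.univ_nonempty
    rw [h0] at h1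
    exact h1 rfl
  have hP0 : μ.prod ρ ≠ 0 := prod_ne_zero_of_map_ne_zero e (by rw [← h]; exact hν0)
  rw [← prod_apply_eq_measure_image e he hes h, prod_prod_of_ne_zero hP0 hS hT]

omit [TopologicalSpace A] [MeasurableSpace A] [BorelSpace A] [IsTopologicalGroup A] [LocallyCompactSpace A] [TopologicalSpace B] [MeasurableSpace B] [BorelSpace B]
  [IsTopologicalGroup B] [SecondCountableTopologyEither A B] in
/-- **Left translations act on the rectangles through the second factor**: `ν(e(S × (b⁻¹ T))) = ν(e(S × T))` — left invariance of `ν` under `e(1, b)` and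
`e(1, b) · e(a, y) = e(a, b y)`. [cite: Gelbart1975, Remark 9.23] -/
theorem measure_image_prod_preimage_mul_left (e : A × B ≃* G) {ν : Measure G} [ν.IsMulLeftInvariant]
    (S : Set A) (T : Set B) (b : B) :
    ν (e '' (S ×ˢ ((fun y => b * y) ⁻¹' T))) = ν (e '' (S ×ˢ T)) := by
  -- `e '' (S × (b⁻¹ T)) = (e(1,b) * ·)⁻¹' (e '' (S × T))`
  have hset : e '' (S ×ˢ ((fun y => b * y) ⁻¹' T)) = (fun z => e (1, b) * z) ⁻¹' (e '' (S ×ˢ T)) := by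
    ext z
    constructor
    · rintro ⟨⟨a, y⟩, ⟨haS, hyT⟩, rfl⟩
      refine ⟨(a, b * y), ⟨haS, hyT⟩, ?_⟩
      show e (a, b * y) = e (1, b) * e (a, y)
      rw [← map_mul, Prod.mk_mul_mk, one_mul]
    · rintro ⟨⟨a, y⟩, ⟨haS, hyT⟩, hq⟩
      refine ⟨(a, b⁻¹ * y), ⟨haS, ?_⟩, ?_⟩
      · show b * (b⁻¹ * y) ∈ T
        rwa [mul_inv_cancel_left]
      · apply e.symm.injective
        rw [MulEquiv.symm_apply_apply]
        have hq' : e.symm (e (a, y)) = e.symm (e (1, b) * z) := by rw [hq]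
        rw [MulEquiv.symm_apply_apply, map_mul, MulEquiv.symm_apply_apply] at hq'
        -- `(a, y) = (1, b) * e.symm z`
        have h1 : (e.symm z).1 = a := by
          have := congrArg Prod.fst hq'
          simpa using this.symm
        have h2 : (e.symm z).2 = b⁻¹ * y := by
          have := congrArg Prod.snd hq'
          simp only [Prod.snd_mul] at this
          rw [this, inv_mul_cancel_left]
        exact Prod.ext h1.symm h2.symm
  rw [hset, measure_preimage_mul]

/-- **THE RIGHT FACTOR OF A PRODUCT DECOMPOSITION OF A HAAR MEASURE IS A HAAR MEASURE.**  `e : A × B ≃* G` a group isomorphism and homeomorphism of topological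
groups, `A` locally compact, `G` Hausdorff, `μ` Haar on `A`, `ν` Haar on `G`, `ρ` ANY measure on `B` with `ν = e_*(μ ⊗ ρ)`: then `ρ` is a Haar measure
(finite on compacta, left invariant, positive on non-empty open sets).  «The measure `dg_f` in `dg = dg_∞ · dg_f` is a Haar measure on `G(𝔸_f)`.»
[cite: Gelbart1975, Remark 9.23] [cite: DeitmarEchterhoff2014, §1.5] -/
theorem isHaarMeasure_of_map_prod_eq (e : A × B ≃* G) (he : Continuous e) (hes : Continuous e.symm)
    (μ : Measure A) [μ.IsHaarMeasure] (ρ : Measure B) (ν : Measure G) [ν.IsHaarMeasure] (h : ν = Measure.map e (μ.prod ρ)) :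
    ρ.IsHaarMeasure := by
  -- a CLOSED compact neighbourhood `S₀` of `1` in `A` (closure of a compact neighbourhood; topological groups are R₁): `0 < μ S₀ < ∞`
  obtain ⟨S₁, hS₁c, hS₁n⟩ := exists_compact_mem_nhds (1 : A)
  set S₀ : Set A := closure S₁ with hS₀
  have hS₀c : IsCompact S₀ := hS₁c.closure
  have hS₀n : S₀ ∈ 𝓝 (1 : A) := Filter.mem_of_superset hS₁n subset_closure
  have hS₀m : MeasurableSet S₀ := isClosed_closure.measurableSet
  have hS₀pos : μ S₀ ≠ 0 := (measure_pos_of_mem_nhds μ hS₀n).ne'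
  have hS₀top : μ S₀ ≠ ∞ := hS₀c.measure_lt_top.ne
  -- (i) finite on compacta (a compact `T` sits in its compact CLOSED, hence measurable, closure)
  have hfin : ∀ ⦃T : Set B⦄, IsCompact T → ρ T < ∞ := by
    intro T hT
    have hrect := measure_image_prod_eq e he hes h hS₀m (isClosed_closure (s := T)).measurableSet
    have hlt : ν (e '' (S₀ ×ˢ closure T)) < ∞ := ((hS₀c.prod hT.closure).image he).measure_lt_top
    rw [hrect] at hlt
    exact (measure_mono subset_closure).trans_lt (ENNReal.lt_top_of_mul_ne_top_right hlt.ne hS₀pos)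
  haveI : IsFiniteMeasureOnCompacts ρ := ⟨hfin⟩
  -- (ii) left invariance
  haveI : ρ.IsMulLeftInvariant := by
    refine ⟨fun b => Measure.ext fun T hT => ?_⟩
    rw [Measure.map_apply (measurable_const_mul b) hT]
    have h1 := measure_image_prod_preimage_mul_left e (ν := ν) S₀ T b
    rw [measure_image_prod_eq e he hes h hS₀m (measurable_const_mul b hT), measure_image_prod_eq e he hes h hS₀m hT] at h1
    exact (ENNReal.mul_right_inj hS₀pos hS₀top).1 h1
  -- (iii) positivity on non-empty open sets
  haveI : ρ.IsOpenPosMeasure := by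
    refine ⟨fun U hUo hUn => ?_⟩
    have hrect := measure_image_prod_eq e he hes h MeasurableSet.univ hUo.measurableSet
    have hopen : IsOpen (e '' (Set.univ ×ˢ U)) := by
      let E : A × B ≃ₜ G := { e.toEquiv with continuous_toFun := he, continuous_invFun := hes }
      have : e '' (Set.univ ×ˢ U) = E '' (Set.univ ×ˢ U) := rfl
      rw [this]
      exact E.isOpenMap _ (isOpen_univ.prod hUo)
    have hne : (e '' (Set.univ ×ˢ U)).Nonempty := (Set.univ_nonempty.prod hUn).image _
    have hpos : ν (e '' (Set.univ ×ˢ U)) ≠ 0 := hopen.measure_ne_zero ν hne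
    rw [hrect] at hpos
    exact right_ne_zero_of_mul hpos
  exact ⟨⟩

end Literature.MeasureTheory.Measure

end
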